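import Summits.ResolutionOfSingularities.ResolutionOfSingularities.Theorems.PurelyInseparableDim4E2DirectrixRow
import Summits.ResolutionOfSingularities.ResolutionOfSingularities.Theorems.PurelyInseparableDim4E2OfCJSIsolation
import HarnessLib

/-!
# F4-I(3,3) from CJS — the row holder's ASSEMBLY after rows (N), (E), (I), (X), (M-a), (M-c) landed:
# `NoIsolatedTrap 3 3` ⟸ [CJS LNM 2270 Thm 6.40, named fact F-111] ∧ [ONE OURS row: (M-b) `LocalizationRow`]
# (cell `res-dim4-pi`, WORD #62 state of record 20:55Z)

[OURS · counted 0 · AI work weaker than expert review.]  Cell `res-dim4-pi` (D-0157 DOOR 2), seat `res-dim4-p-2`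
g2 (holder of the E2 transfer rows).  NOTHING here proves (M-b), `NoIsolatedTrap 3 3` unconditionally, or resolution
of singularities in dimension ≥ 4 / characteristic `p`.

The E2 transfer row `IsolatedConeTwoChainLocalizes` (p663256) was cut into (M)(N)(E)(I)(X) (p663940) and (M) into
(M-a)(M-b) (p665567).  Landed: (N) `nearRow` (res-dim4-p-1 g2, p664524; adapter p666374) · (E) `directrixRow`
(res-dim4-p-1 g2 ⊃ res-dim4-p-5 g2 / res-dim4-p-3 g2, p666993) · (I) `isolationRow` (res-dim4-p-11 g2, p665211 +
p666809) · (X) `settingRow` (p664844) · (M-a) `globalModel_of_coneTwoChain` (p665319) · (M-c) strict transform =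
blow-up of the hypersurface (res-dim4-p-5 g2, p666342; consumed inside (M-b)).  OPEN: (M-b) `LocalizationRow`
(res-dim4-p-7 g2).  Hence, sorry-free and by name:

**`noIsolatedTrap_three_three_of_CJS_of_localizationRow : KeyTheorem640_char_localized_isolated → LocalizationRow →
NoIsolatedTrap 3 3`.**

[DIM4 · CJS-ROW] consumed: F-111 `Literature.AlgebraicGeometry.CossartJannsenSaito2020.KeyTheorem640_char_localized_isolated`
only.  bears_on: LADDER-RESOLUTION:D157-DOOR2 (res-dim4-pi · F4-I(3,3) · CJS dictionary · assembly).  Supports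
stmt-ResolutionOfSingularities-16155 (helper).
-/

set_option linter.dupNamespace false -- mandated namespace of this single-conjunct summit

noncomputable section

open Literature.AlgebraicGeometry.CossartJannsenSaito2020

namespace Summit.ResolutionOfSingularities.ResolutionOfSingularities.Theorems.PIDim4

namespace E2OfCJS

/-- **F4-I(3,3) ⟸ CJS Thm. 6.40 ∧ (M-b).**  With (N), (E), (I), (X), (M-a) theorems of the tree, the crux
`NoIsolatedTrap 3 3` follows from the named fact `KeyTheorem640_char_localized_isolated` (Cossart–Jannsen–Saito,
LNM 2270 Thm. 6.40, unit-wise localised isolated form) and the ONE remaining OURS row `LocalizationRow` (the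
localisation of the global model, res-dim4-p-7 g2). [OURS · conditional assembly] [cite: CossartJannsenSaito2020, Thm. 6.40] -/
theorem noIsolatedTrap_three_three_of_CJS_of_localizationRow (hK640 : KeyTheorem640_char_localized_isolated.{0})
    (hMb : LocalizationRow) : NoIsolatedTrap 3 3 :=
  noIsolatedTrap_three_three_of_CJS_of_localization_isolation hK640 hMb isolationRow

/-- The same with the transfer row of p663256 ITSELF reduced: `IsolatedConeTwoChainLocalizesAlgClosed` (hence the
per-field endgame's hypothesis) follows from (M-b) alone. [OURS · glue] [folklore] -/
theorem isolatedConeTwoChainLocalizesAlgClosed_of_localizationRow (hMb : LocalizationRow) :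
    IsolatedConeTwoChainLocalizesAlgClosed :=
  isolatedConeTwoChainLocalizesAlgClosed_of_rows (modelRow_of_localizationRow hMb) nearRow directrixRow isolationRow
    settingRow

end E2OfCJS

end Summit.ResolutionOfSingularities.ResolutionOfSingularities.Theorems.PIDim4

end
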